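import Summits.HubbardSuperconductivity.HubbardSuperconductivity.Theorems.AnisotropyChordTransferFibre3FinXB2Eval
import Summits.HubbardSuperconductivity.HubbardSuperconductivity.Theorems.AnisotropyChordTransferFibre3FinXCCover

/-!
# Route `AnisotropyChord` / H0 rotor rung: FIN mid-`L` COMBINED certificate XBC2 (rows `N₁` + C) — computable part

The combined cell certificate of g5 (`…FinXCEval.xbcCellOK`: row `N₁` with constant `c`, row C with constant `b = bn/bd`) on top
of the XB2 evaluator (`…FinXB2Eval`: two-propagator table from the two point wedges `tlo`, `thi`): the row-C objects
`xcObj L la lb S O` (g4 row–column tables, `O(L³)`) are unchanged and read the scalars and the `T⁺` brackets from the XB2 objects.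
`xbcCellOK2`, `xbcCellAnyT2` (point wedges as arguments: recomputed or certified literal tables), `xbcCellAny2`, ★ `xbcCheck2`.
Soundness: `…FinXC2Cell` / `…FinXC2Cover`.
Prover seat `hubbard-h0-rotor-p3` g6; helper for piece A = stmt-HubbardSuperconductivity-23918 of rung 19089 (`--supports`, helper
class).  WHAT THIS IS NOT: nothing here proves superconductivity in the Hubbard model (rotor TARGET as worded stays FALSE, g15 verdict);
evaluator infrastructure for the FIN certificates of ONE conditional reduction.  Tree imports only; no sorry, no new axioms.
-/

set_option linter.dupNamespace false
set_option autoImplicit false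

namespace Summit.HubbardSuperconductivity.HubbardSuperconductivity.Theorems.AnisotropyChord.Transfer.Fibre3

namespace FinXB

open Hole2 FinCell

/-- ★ THE COMBINED XBC2 CELL CERTIFICATE (row `N₁` with constant `c`, row C with constant `b = bn/bd`), given the point wedges. -/
def xbcCellOK2 (L : ℕ) (la lb : ℤ) (c : ℚ) (bn bd : ℕ) (tlo thi : List (List Iv)) : Bool :=
  let E := xbEval2 L la lb tlo thi
  let C := xcObj L la lb E.1 E.2
  (groundCellCheck L la lb && xbScalOK L la lb && gPtNonneg L la && decide (0 < E.2.P.1) && decide (0 ≤ c) &&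
    decide (c * (((3 * ((L : ℤ) * L) ^ 2 * tPlusHi E.1 E.2 : ℤ)) : ℚ) ≤ ((n1Lo E.1 E.2 : ℤ) : ℚ))) &&
  (decide (0 < bd) && xcMok L (fTab4 L la lb) C.M && decide (0 ≤ C.tlo) && decide (C.thi ≤ 2 * E.1.eps1.1) &&
    decide (0 ≤ C.eta.1) && decide (sqSum C ≤ rhsLo L E.1 C bn bd))

/-- one cell of the combined cover, given the point wedges: vacuous (numerator / `Δ < 0` / `Δ > Δ₁`) or certified. -/
def xbcCellAnyT2 (L : ℕ) (d1 : ℚ) (bd : ℕ) (la lb : ℤ) (cb : ℚ × ℕ) (tlo thi : List (List Iv)) : Bool :=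
  (denCellPos L (cosTab L) la lb && decide ((numIv L la lb).2 < 0) && decide (0 ≤ (G0Iv L la lb).1)) ||
  (groundCellCheck L la lb &&
    (decide ((deltaIv L la lb).2 < 0) || decide (d1 * (D : ℚ) < (((deltaIv L la lb).1 : ℤ) : ℚ)))) ||
  xbcCellOK2 L la lb cb.1 cb.2 bd tlo thi

/-- ★ one cell of the combined cover with the point wedges recomputed (or rewritten to certified literal tables). -/
def xbcCellAny2 (L : ℕ) (d1 : ℚ) (bd : ℕ) (la lb : ℤ) (cb : ℚ × ℕ) : Bool :=
  xbcCellAnyT2 L d1 bd la lb cb (tWedgePt L la) (tWedgePt L lb)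

/-- ★ THE PER-`L` COMBINED CERTIFICATE (XBC2) on `0 < Δ ≤ Δ₁`. -/
def xbcCheck2 (L : ℕ) (d1 : ℚ) (bd : ℕ) (cells : List (ℤ × ℚ × ℕ)) : Bool :=
  decide ((cells.head?.map Prod.fst) = some 0) && decide (2 ≤ cells.length) && decide (lamTop L ≤ cellsLastC cells)
    && decide (0 < bd) && cellsAllC (xbcCellAny2 L d1 bd) cells

end FinXB

end Summit.HubbardSuperconductivity.HubbardSuperconductivity.Theorems.AnisotropyChord.Transfer.Fibre3
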